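import Summits.Ventures.HodgeKum4.Statement
import Summits.HodgeConjecture.HodgeConjecture.Theorems.Ring2AbelianAllAndreCorrespondenceCategory
import Literature.AlgebraicGeometry.HodgeTheory.LefschetzStandardUnconditionalDegrees
import Literature.AlgebraicTopology.SingularHomology.CupProductProofs
import Literature.AlgebraicGeometry.HodgeTheory.DualLefschetzInLefschetzInvolutionAlgebra
import Literature.AlgebraicGeometry.HodgeTheory.MotivatedClassesAlgebraic
import Literature.AlgebraicGeometry.HodgeTheory.ComplexGysin
import HarnessLib

/-!
# Degreewise-algebraic operators on `H*(Y(ℂ); ℂ)`: the subalgebra generated by `L_η` and `*_L`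
(cell `hodge-kum4`, seat p2; step (iii) of the kernel plan for the span-form node L2a′ of route
`KummerFixedLocus`)

HONEST FRAMING.  Bookkeeping, no named fact.  Call a total operator `E ∈ End H*(Y(ℂ); ℂ)`
*degreewise `0`-or-algebraic* when every degree component `Hᵏ → Hᵐ` of `E` is the zero map or is
induced by an algebraic correspondence (`HodgeTheory.IsAlgebraicCorrespondence n n Y Y`); the predicate
is spelled out, not named.  Proved here, for `Y` smooth projective of dimension `n`:
* the components of a product are the finite sums `Σ_{j ≤ 2n} A_{m j} ∘ B_{j k}` (`H^j = 0` for `j > 2n`),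
  so degreewise `0`-or-algebraic operators are closed under `+`, `*` and scalars (ring 2's
  `IsAlgebraicCorrespondence.comp/.add/.smul`, Fulton Prop. 16.1.1);
* `L_η` (`totalLefschetz η`, `η ∈ N¹ H²`) and André's `*_L` (`totalLefschetzInvolution hL`, granted
  that its degree components `lefschetzInvolution hL` are algebraic — Grothendieck's `B(Y)` in André's
  form, e.g. Foster 2024 for `Kumⁿ`-type with `n + 1` prime) are degreewise `0`-or-algebraic;
* hence (`Algebra.adjoin_induction`) so is every element of `Algebra.adjoin ℂ {L_η, *_L}` — in
  particular André's `ᶜΛ` (`Andre1996_dualLefschetz_mem_adjoin_lefschetzInvolution`, the GUARDED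
  printed fact, consumed by name only downstream).
-/

noncomputable section

open CategoryTheory DirectSum
open Literature.AlgebraicGeometry Literature.AlgebraicGeometry.Motives Literature.AlgebraicGeometry.HodgeTheory
open Literature.AlgebraicGeometry.Hyperkaehler
open Literature.AlgebraicTopology.SingularHomology Literature.Geometry.Kaehler
open Summit.HodgeConjecture.HodgeConjecture.Ring2.AbelianAll (IsAlgebraicCorrespondence.comp
  IsAlgebraicCorrespondence.add IsAlgebraicCorrespondence.smul IsAlgebraicCorrespondence.le_two_mul)

namespace Summit.Ventures.HodgeKum4

variable {n : ℕ} {Y : SchemeOver ℂ}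

/-! ### Plumbing on `H* = ⨁ₖ Hᵏ` -/

/-- **`L_η = η ∪ ·` is an algebraic correspondence** for `η ∈ N¹ H²(Y(ℂ))` (`η ∪ c = c ∪ η` by graded
commutativity in even degree, and `(· ∪ η) = [Δ_* η]^*`,
`isAlgebraicCorrespondence_flip_cupProduct_of_mem_algebraicClasses`; the same 6 lines as the
HodgeConjecture summit's `isAlgebraicCorrespondence_lefschetzOperator`, copied to keep this module's
imports inside Literature + ring 2). -/
theorem isAlgebraicCorrespondence_lefschetzOperator_of_mem (hY : IsSmoothProjective n Y)
    {η : complexBetti Y 2} (hη : η ∈ algebraicClasses Y 1) {a b : ℕ} (h : 2 + a = b)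
    (hb : b ≤ 2 * n) : IsAlgebraicCorrespondence n n Y Y (lefschetzOperator η h) := by
  have hab : a + 2 * 1 = b := by omega
  have heq : lefschetzOperator η h = (cupProduct hab).flip η := by
    refine LinearMap.ext fun c => ?_
    rw [lefschetzOperator_apply, LinearMap.flip_apply, cupProduct_gradedComm_holds ℂ _ h hab η c,
      (even_two_mul a).neg_one_pow, one_smul]
  rw [heq]
  exact isAlgebraicCorrespondence_flip_cupProduct_of_mem_algebraicClasses hY hab hb hη

/-- Every class of `H*(Y(ℂ); ℂ)` is the sum of its components of degree `≤ 2 dim Y` (the others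
vanish). -/
theorem eq_sum_range_ofDegree (hY : IsSmoothProjective n Y)
    (w : totalCohomology ℂ (Motives.ComplexPoints Y)) :
    w = ∑ j ∈ Finset.range (2 * n + 1), ofDegree ℂ (Motives.ComplexPoints Y) j (w j) := by
  classical
  refine DirectSum.ext_component ℂ fun i => ?_
  rw [map_sum]
  by_cases hi : i ≤ 2 * n
  · rw [Finset.sum_eq_single i, DirectSum.component.lof_self]
    · rfl
    · intro j _ hji
      rw [DirectSum.component.of, dif_neg hji]
    · intro h
      exact absurd (Finset.mem_range.2 (by omega)) h
  · haveI := subsingleton_complexBetti hY (k := i) (not_le.1 hi)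
    exact Subsingleton.elim _ _

/-- The `(m, k)` component of a product: `(A B)_{m k} = Σ_{j ≤ 2n} A_{m j} ∘ B_{j k}`. -/
theorem component_mul_eq_sum (hY : IsSmoothProjective n Y)
    (A B : Module.End ℂ (totalCohomology ℂ (Motives.ComplexPoints Y))) (k m : ℕ) :
    DirectSum.component ℂ ℕ _ m ∘ₗ (A * B) ∘ₗ ofDegree ℂ (Motives.ComplexPoints Y) k =
      ∑ j ∈ Finset.range (2 * n + 1),
        (DirectSum.component ℂ ℕ _ m ∘ₗ A ∘ₗ ofDegree ℂ (Motives.ComplexPoints Y) j) ∘ₗ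
          (DirectSum.component ℂ ℕ _ j ∘ₗ B ∘ₗ ofDegree ℂ (Motives.ComplexPoints Y) k) := by
  refine LinearMap.ext fun c => ?_
  simp only [LinearMap.coe_comp, Function.comp_apply, Module.End.mul_apply, LinearMap.sum_apply]
  conv_lhs => rw [eq_sum_range_ofDegree hY (B (ofDegree ℂ (Motives.ComplexPoints Y) k c))]
  rw [map_sum, map_sum]
  rfl

/-! ### Degreewise `0`-or-algebraic operators form a subalgebra -/

/-- On maps `Hᵏ → Hᵐ` the property "`= 0` or algebraic" is closed under addition. -/
theorem zero_or_isAlgebraicCorrespondence_add (hY : IsSmoothProjective n Y) {k m : ℕ}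
    {S T : complexBetti Y k →ₗ[ℂ] complexBetti Y m}
    (hS : S = 0 ∨ IsAlgebraicCorrespondence n n Y Y S) (hT : T = 0 ∨ IsAlgebraicCorrespondence n n Y Y T) :
    S + T = 0 ∨ IsAlgebraicCorrespondence n n Y Y (S + T) := by
  rcases hS with rfl | hS
  · simpa using hT
  rcases hT with rfl | hT
  · rw [add_zero]; exact Or.inr hS
  exact Or.inr (IsAlgebraicCorrespondence.add hY hY hS hT)

/-- … and under finite sums. -/
theorem zero_or_isAlgebraicCorrespondence_sum (hY : IsSmoothProjective n Y) {k m : ℕ} {ι : Type*}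
    (s : Finset ι) (T : ι → (complexBetti Y k →ₗ[ℂ] complexBetti Y m))
    (hT : ∀ i ∈ s, T i = 0 ∨ IsAlgebraicCorrespondence n n Y Y (T i)) :
    ∑ i ∈ s, T i = 0 ∨ IsAlgebraicCorrespondence n n Y Y (∑ i ∈ s, T i) := by
  classical
  induction s using Finset.induction_on with
  | empty => simp
  | insert a s ha ih =>
    rw [Finset.sum_insert ha]
    exact zero_or_isAlgebraicCorrespondence_add hY (hT a (Finset.mem_insert_self a s))
      (ih fun i hi => hT i (Finset.mem_insert_of_mem hi))

/-- … and under composition (degrees `k → j → m`). -/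
theorem zero_or_isAlgebraicCorrespondence_comp (hY : IsSmoothProjective n Y) {k j m : ℕ}
    {S : complexBetti Y k →ₗ[ℂ] complexBetti Y j} {T : complexBetti Y j →ₗ[ℂ] complexBetti Y m}
    (hS : S = 0 ∨ IsAlgebraicCorrespondence n n Y Y S) (hT : T = 0 ∨ IsAlgebraicCorrespondence n n Y Y T) :
    T ∘ₗ S = 0 ∨ IsAlgebraicCorrespondence n n Y Y (T ∘ₗ S) := by
  rcases hS with rfl | hS
  · exact Or.inl (LinearMap.comp_zero T)
  rcases hT with rfl | hT
  · exact Or.inl (LinearMap.zero_comp S)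
  by_cases hk : k ≤ 2 * n
  · exact Or.inr (IsAlgebraicCorrespondence.comp hY hY hY hS hT (by omega))
  · haveI := subsingleton_complexBetti hY (k := k) (not_le.1 hk)
    exact Or.inl (LinearMap.ext fun c => by rw [Subsingleton.elim c 0, map_zero, map_zero])

/-- **Every element of `Algebra.adjoin ℂ {L_η, *_L}` is degreewise `0`-or-algebraic**, granted
`η ∈ N¹ H²(Y(ℂ))` and the algebraicity of the degree components of `*_L` (`B(Y)` in André's form). -/
theorem zero_or_isAlgebraicCorrespondence_of_mem_adjoin (hY : IsSmoothProjective n Y)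
    {η : complexBetti Y 2} (hη : η ∈ algebraicClasses Y 1) (hL : HasHardLefschetzProperty η n)
    (hB : ∀ (a b : ℕ) (hab : a + b = 2 * n), IsAlgebraicCorrespondence n n Y Y (lefschetzInvolution hL hab))
    {E : Module.End ℂ (totalCohomology ℂ (Motives.ComplexPoints Y))}
    (hE : E ∈ Algebra.adjoin ℂ
      ({totalLefschetz η, totalLefschetzInvolution hL} :
        Set (Module.End ℂ (totalCohomology ℂ (Motives.ComplexPoints Y))))) (k m : ℕ) :
    DirectSum.component ℂ ℕ _ m ∘ₗ E ∘ₗ ofDegree ℂ (Motives.ComplexPoints Y) k = 0 ∨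
      IsAlgebraicCorrespondence n n Y Y
        (DirectSum.component ℂ ℕ _ m ∘ₗ E ∘ₗ ofDegree ℂ (Motives.ComplexPoints Y) k) := by
  classical
  revert k m
  refine Algebra.adjoin_induction (p := fun E _ => ∀ k m : ℕ,
      DirectSum.component ℂ ℕ _ m ∘ₗ E ∘ₗ ofDegree ℂ (Motives.ComplexPoints Y) k = 0 ∨
        IsAlgebraicCorrespondence n n Y Y
          (DirectSum.component ℂ ℕ _ m ∘ₗ E ∘ₗ ofDegree ℂ (Motives.ComplexPoints Y) k))
    ?_ ?_ ?_ ?_ hE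
  · -- generators
    rintro F hF k m
    simp only [Set.mem_insert_iff, Set.mem_singleton_iff] at hF
    rcases hF with rfl | rfl
    · -- `L_η`: component `(m, k)` is `lefschetzOperator η` if `m = k + 2`, else `0`
      by_cases hm : m = k + 2
      · subst hm
        by_cases hb : k + 2 ≤ 2 * n
        · right
          have heq : DirectSum.component ℂ ℕ _ (k + 2) ∘ₗ totalLefschetz η ∘ₗ
              ofDegree ℂ (Motives.ComplexPoints Y) k = lefschetzOperator η (Nat.add_comm 2 k) := by
            refine LinearMap.ext fun c => ?_
            simp only [LinearMap.coe_comp, Function.comp_apply, totalLefschetz_lof]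
            rw [DirectSum.component.lof_self]
          rw [heq]
          exact isAlgebraicCorrespondence_lefschetzOperator_of_mem hY hη _ hb
        · left
          haveI := subsingleton_complexBetti hY (k := k + 2) (not_le.1 hb)
          exact LinearMap.ext fun c => Subsingleton.elim _ _
      · left
        refine LinearMap.ext fun c => ?_
        simp only [LinearMap.coe_comp, Function.comp_apply, totalLefschetz_lof, LinearMap.zero_apply]
        rw [DirectSum.component.of, dif_neg (fun h => hm h.symm)]
    · -- `*_L`: component `(m, k)` is `lefschetzInvolution` if `k ≤ 2n` and `m = 2n - k`, else `0`
      by_cases hk : k ≤ 2 * n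
      · by_cases hm : m = 2 * n - k
        · subst hm
          right
          have heq : DirectSum.component ℂ ℕ _ (2 * n - k) ∘ₗ totalLefschetzInvolution hL ∘ₗ
              ofDegree ℂ (Motives.ComplexPoints Y) k =
                lefschetzInvolution hL (show k + (2 * n - k) = 2 * n by omega) := by
            refine LinearMap.ext fun c => ?_
            simp only [LinearMap.coe_comp, Function.comp_apply, totalLefschetzInvolution_ofDegree hL hk]
            rw [DirectSum.component.lof_self]
          rw [heq]
          exact hB _ _ _
        · left
          refine LinearMap.ext fun c => ?_
          simp only [LinearMap.coe_comp, Function.comp_apply, totalLefschetzInvolution_ofDegree hL hk,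
            LinearMap.zero_apply]
          rw [DirectSum.component.of, dif_neg (fun h => hm h.symm)]
      · left
        refine LinearMap.ext fun c => ?_
        simp only [LinearMap.coe_comp, Function.comp_apply,
          totalLefschetzInvolution_ofDegree_of_lt hL (not_le.1 hk), map_zero, LinearMap.zero_apply]
  · -- scalars `r • 1`
    intro r k m
    by_cases hm : m = k
    · subst hm
      by_cases hk : m ≤ 2 * n
      · right
        have heq : DirectSum.component ℂ ℕ _ m ∘ₗ
            (algebraMap ℂ (Module.End ℂ (totalCohomology ℂ (Motives.ComplexPoints Y))) r) ∘ₗ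
              ofDegree ℂ (Motives.ComplexPoints Y) m = r • (complexBetti.map (𝟙 Y) m).hom := by
          refine LinearMap.ext fun c => ?_
          simp only [LinearMap.coe_comp, Function.comp_apply, Module.algebraMap_end_apply, map_smul,
            LinearMap.smul_apply, complexBetti.map_id]
          rw [DirectSum.component.lof_self]
          rfl
        rw [heq]
        exact IsAlgebraicCorrespondence.smul hY hY (isAlgebraicCorrespondence_map hY hY (𝟙 Y) hk) r
      · left
        haveI := subsingleton_complexBetti hY (k := m) (not_le.1 hk)
        exact LinearMap.ext fun c => by rw [Subsingleton.elim c 0, map_zero, LinearMap.zero_apply]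
    · left
      refine LinearMap.ext fun c => ?_
      simp only [LinearMap.coe_comp, Function.comp_apply, Module.algebraMap_end_apply, map_smul,
        LinearMap.zero_apply]
      rw [DirectSum.component.of, dif_neg (fun h => hm h.symm), smul_zero]
  · -- sums
    intro A B _ _ hA hB' k m
    have h := zero_or_isAlgebraicCorrespondence_add hY (hA k m) (hB' k m)
    simpa only [LinearMap.comp_add, LinearMap.add_comp] using h
  · -- products
    intro A B _ _ hA hB' k m
    rw [component_mul_eq_sum hY A B k m]
    exact zero_or_isAlgebraicCorrespondence_sum hY _ _ fun j _ =>
      zero_or_isAlgebraicCorrespondence_comp hY (hB' k j) (hA j m)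

end Summit.Ventures.HodgeKum4

end
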